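import Summits.QuantumFields.YangMills.Theorems.UnitScaleGibbsTestFieldSU2DressingPush
import Summits.QuantumFields.YangMills.Theorems.UnitScaleGibbsTruncatedPotentialEnergyMass
import Summits.QuantumFields.YangMills.Theorems.GrossTransferStubLinTestWeightReadoutRows
import Literature.MathematicalPhysics.QuantumFieldTheory.Balaban1983to89.T3ContinuumYM3Torus
import HarnessLib

/-!
# `GrossTransferStubLinTestEnergyMassRows` — THE (R5) ENERGY AND (R6) MASS ROWS OF `stub_linTest`'s KNIT-E2 SKELETON AS ROW LEMMAS
# (LINE 28 «GrossTransfer»; crux `UnitScaleTilt.HistoryTailL` stmt-QuantumFields-19936 ∕ `MeanDeviationL` stmt-QuantumFields-23083)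

Cell `ym3-torus` (YM ladder rung R3 = continuum SU(2) Yang–Mills on every three-torus — a RUNG, NOT d = 4, NOT infinite volume, NOT a mass gap, NOT the
Clay problem); width seat `ym-ust-19936-w5` gen 17, on the pen of record's word (★w2-19936 g15 22:19:08Z «OFFER-BACK: two ROW LEMMAS in the bullets' exact
goal shape with the skeleton's hypotheses as binders — I then close each bullet by `exact` + the STEP-0 arithmetic»).  The KNIT-E2 skeleton v2.1
(`GrossTransferStubLinTestPointwisePackage`, HOME 4108a9e0, pen w2) fixes, inside `main_estimate`, the member `F`, the level `K`, the dressing box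
`lo = z₀ − (3R+2)`, `hi = z₀ + (3R+4)` (`hNbox`), the `ℤ³` objects as FREE SYMBOLS with defining equations — `wt` (antisymmetrised `linWeight` read-out on
`Q_{R₀}(z₀)`), `βt = (G∕2)∗wt`, `at' = δ₂βt`, `γt = d₂βt`, the cutoff `χ` of ✓`exists_smooth_cutoff z₀ R` (`hχ01 hχ1 hχ0 hχp`), `aR = χ·at'`, `daR` — the push
`u0` of `aR` (✓`exists_push`: `hu0`, `hu0off`) and the dressed test field `u α b = (u0 b : ℂ) • (I • pauli α)`; its open bullets (R5)∕(R6) ask for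
`Σ_p ‖(du α)_p‖_F² ≤ C·L^j` and `Σ_b ‖u α b‖_F² ≤ C·L^{16j}`.  THIS FILE types the two rows UP TO THE PEN's CONSTANT: with exactly those binders,
* ★★★`mass_row` (R6): `∀ α, Σ_b ‖(u0 b : ℂ) • (iσ_α)‖_F² ≤ 2·#Q_{3R}(z₀)·(3·(½(K₀+C₁)·M₀)²)`, `M₀ := Σ_μΣ_νΣ_{y∈Q_{R₀}(z₀)}|wt y μ ν|`, `K₀ := Σ_e|G(e_e) − G(0)|`
  — DRESS ✓`sum_norm_sq_dress` (factor `2 = ‖iσ_α‖_F²`) + ✓`sum_sq_push_eq_sum_box` (torus → `Π[lo,hi]`) + KNIT-D ✓`sum_sq_truncated_le` (`B := Π[lo,hi]`);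
* ★★★`energy_row` (R5): `∀ α, Σ_p ‖(du α)_p‖_F² ≤ 2·[2·(2 + 18·3²)·Σ_{Q_{R₀}}ΣΣ wt² + 2·#Q_{3R+1}(z₀)·9·((2∕R)·3·(C₁∕N²)·M₀)²]` for every `N ≥ 1` with
  `N + R₀ + 2 ≤ R` — DRESS ✓`sum_norm_sq_curl_dress` + ✓`sum_sq_curl_push_le_sum_sum_box` + KNIT-D ✓`sum_sq_curl_truncated_le_far'`;
* ★★★`energy_row_le` (R5 ALL THE WAY TO `C5·L^j`, the pen's word 22:39:30Z «(R5) next — yours»): with the KNIT-E2 skeleton's `hwt` letter itself (so the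
  STEP-0 prices ✓`GrossTransferStubLinTestWeightReadoutRows.readout_sq_sum_le` ∕ `readout_abs_sum_le` apply: `Σwt² ≤ 2L^j`, `M₀ ≤ 2L^{2j}`) and the size rows
  the skeleton's `R = (R₀+12)·L^{3j}`, `N := R − R₀ − 2` satisfy (`12·(L^j)³ ≤ R`, `R ≤ 2N`), `∀ α, Σ_p ‖(du α)_p‖_F² ≤ (1312 + 34992·C₁²)·L^j`
  (`energy_arith`: `#Q_{3R+1} = (6R+3)³ ≤ 729R³` by lit ✓`card_box`, `N⁴ ≥ R⁴∕16`, `M₀²∕R³ ≤ 1∕432`, far term `≤ 8748·C₁²`, main term `≤ 1312·L^j`).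
The `Fin (F.P K).d` ∕ `Fin 3` seam (`T3Family.P_d : (F.P K).d = 3`, `rfl`) is crossed INSIDE the proofs; the statements are in the skeleton's own types.
HONEST SCOPE.  Two rows of a helper package, modulo the pen's constant; proves no stub and closes no item.  Nothing of `main_estimate`, `stub_linTest`,
«ShallowFluxSecondMomentL», (Q), 23083∕23133∕23134, K1, `stub_pinnedStep`∕`stub_unitEnvelope` or `HistoryTailL` is proved.  YM₃ on T³ is rung R3 — NOT
d = 4, NOT a mass gap, NOT Clay.
References: T. Bałaban, CMP **96** (1984) 223–250, (1.9) p. 226 [Balaban1984PropagatorsII]; CMP **95** (1984) 17–40, (1.10) p. 19 [Balaban1984PropagatorsI];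
G. Lawler, Intersections of Random Walks (1991), Thm 1.5.5 [Lawler1991]; L. Gross, CMP **92** (1983) 137–162, Thm 2.2 [GrossCMP1983].
-/

set_option autoImplicit false

noncomputable section

open scoped BigOperators Matrix Matrix.Norms.Frobenius
open Complex Finset
open Literature.Probability.LatticeModels (latticeGreen)
open Literature.MathematicalPhysics.QuantumFieldTheory.Balaban1983to89
open Literature.MathematicalPhysics.QuantumFieldTheory.Balaban1983to89.T3ContinuumYM3Torus
open Literature.MathematicalPhysics.QuantumFieldTheory.Balaban1983to89.B4Eq19LatticeOperators (Zd unitVec box mem_box card_box)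
open Literature.MathematicalPhysics.QuantumFieldTheory.Balaban1983to89.T4AxialGaugeSmallField (castSite)
open Literature.MathematicalPhysics.QuantumFieldTheory.Balaban1983to89.B7Prop1Explicit (e)
open Literature.MathematicalPhysics.QuantumFieldTheory.Balaban1983to89.B10Eq18SigmaSU2 (pauli)
open Summit.QuantumFields.YangMills.Theorems.UnitScaleGibbsActionDerivativeSlotCalculus (slotBond)
open Summit.QuantumFields.YangMills.Theorems.UnitScaleGibbsTestFieldSU2Dressing (sum_norm_sq_dress sum_norm_sq_curl_dress)
open Summit.QuantumFields.YangMills.Theorems.UnitScaleGibbsTestFieldSU2DressingPush (sum_sq_push_eq_sum_box sum_sq_curl_push_le_sum_sum_box)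
open Summit.QuantumFields.YangMills.Theorems.UnitScaleGibbsTruncatedPotentialEnergyMass (sum_sq_truncated_le sum_sq_curl_truncated_le_far')
open Summit.QuantumFields.YangMills.Theorems.UnitScaleGibbsBlockPlaquetteLinWeight (linWeight)
open Summit.QuantumFields.YangMills.Theorems.GrossTransferStubLinTestWeightReadoutRows (readout_of_not_mem readout_sq_sum_le readout_abs_sum_le)

namespace Summit.QuantumFields.YangMills.Theorems.GrossTransferStubLinTestEnergyMassRows

/-! ## §1 (R6) the mass row -/

/-- ★★★ **(R6) THE MASS ROW OF THE KNIT-E2 SKELETON, UP TO THE PEN's CONSTANT.**  In the skeleton's binders (member `F`, level `K`, dressing box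
`[lo, hi]` non-wrapping, kernel row `hK1` with constant `C₁ ≥ 0`, `βt = (G∕2)∗wt` on `Q_{R₀}(z₀)`, `at' = δ₂βt`, cutoff `0 ≤ χ ≤ 1` vanishing off
`Q_{3R}(z₀)`, `aR = χ·at'` with the margin row, its push `u0`):
`∀ α, Σ_b ‖(u0 b : ℂ) • (iσ_α)‖_F² ≤ 2·#Q_{3R}(z₀)·(3·(½(K₀ + C₁)·M₀)²)`, `K₀ = Σ_e |G(e_e) − G(0)|`, `M₀ = Σ_μΣ_νΣ_{y∈Q_{R₀}(z₀)} |wt y μ ν|`.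
[cite: Balaban1984PropagatorsII, (1.9) p.226] [cite: Lawler1991, Thm 1.5.5] -/
theorem mass_row (F : T3Family) (K : ℕ) {lo hi : Fin (F.P K).d → ℤ} (hN : ∀ κ, hi κ - lo κ < (F.P K).sitesPerDir 0)
    {C₁ : ℝ} (hC₁ : 0 ≤ C₁)
    (hK1 : ∀ (e : Fin 3) (w : Zd 3) (n : ℕ), 1 ≤ n → w ∉ box (0 : Zd 3) ((n : ℤ) - 1) →
      |latticeGreen (w + unitVec e) - latticeGreen w| ≤ C₁ / (n : ℝ) ^ 2)
    (wt βt : Zd (F.P K).d → Fin (F.P K).d → Fin (F.P K).d → ℝ) (at' : Zd (F.P K).d → Fin (F.P K).d → ℝ)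
    (z₀ : Zd (F.P K).d) (R₀ : ℕ)
    (hβt : ∀ x μ ν, βt x μ ν = ∑ y ∈ box z₀ (R₀ : ℤ), latticeGreen (x - y) / 2 * wt y μ ν)
    (hat : ∀ x ν, at' x ν = ∑ μ, (βt (x - unitVec μ) μ ν - βt x μ ν))
    (χ : Zd (F.P K).d → ℝ) (aR : Zd (F.P K).d → Fin (F.P K).d → ℝ) (R : ℕ)
    (hχ01 : ∀ x, 0 ≤ χ x ∧ χ x ≤ 1) (hχ0 : ∀ x, x ∉ box z₀ (3 * (R : ℤ)) → χ x = 0)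
    (haR : ∀ x ν, aR x ν = χ x * at' x ν)
    (haR1 : ∀ x μ, aR x μ ≠ 0 → lo + 1 ≤ x ∧ x + unitVec μ + 1 ≤ hi)
    (u0 : PBond (F.P K) 0 → ℝ)
    (hu0 : ∀ (x : Fin (F.P K).d → ℤ) (μ : Fin (F.P K).d), lo ≤ x → x + e μ ≤ hi → u0 ⟨castSite x, μ⟩ = aR x μ)
    (hu0off : ∀ b : PBond (F.P K) 0, (¬ ∃ y : Fin (F.P K).d → ℤ, lo ≤ y ∧ y + e b.dir ≤ hi ∧ b.src = castSite y) → u0 b = 0) :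
    ∀ α : Fin 3, ∑ b : PBond (F.P K) 0, ‖((u0 b : ℝ) : ℂ) • (I • pauli α)‖ ^ 2 ≤
      2 * ((((box z₀ (3 * (R : ℤ))).card : ℕ) : ℝ) *
        (3 * (1 / 2 * ((∑ e' : Fin 3, |latticeGreen (unitVec e') - latticeGreen (0 : Zd 3)|) + C₁) *
          ∑ μ : Fin 3, ∑ ν' : Fin 3, ∑ y ∈ box z₀ (R₀ : ℤ), |wt y μ ν'|) ^ 2)) := by
  classical
  intro α
  rw [sum_norm_sq_dress, sum_sq_push_eq_sum_box hN aR haR1 u0 hu0 hu0off]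
  refine mul_le_mul_of_nonneg_left ?_ (by norm_num)
  -- KNIT-D's mass row on `ℤ³` with `B := Π[lo,hi]`, `S := 3R` (the `(F.P K).d = 3` seam is `rfl`)
  have hχ0' : ∀ x : Zd 3, x ∉ box z₀ ((3 * R : ℕ) : ℤ) → χ x = 0 := by
    intro x hx
    apply hχ0
    push_cast at hx
    exact hx
  have h := sum_sq_truncated_le hK1 wt βt at' z₀ R₀ hβt hat χ aR (3 * R) hχ01 hχ0' haR hC₁
    (Fintype.piFinset fun i => Finset.Icc (lo i) (hi i))
  have hcast : (((3 * R : ℕ) : ℤ)) = 3 * (R : ℤ) := by push_cast; ring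
  rw [hcast] at h
  exact h

/-! ## §2 (R5) the energy row -/

/-- ★★★ **(R5) THE ENERGY ROW OF THE KNIT-E2 SKELETON, UP TO THE PEN's CONSTANT.**  In the skeleton's binders (as in `mass_row`, plus `wt = 0` off
`Q_{R₀}(z₀)`, `γt = d₂βt`, the plateau row `χ = 1` on `Q_R(z₀)`, the gradient row `|∇χ| ≤ 2∕R`, `daR` = the `ℤ³` curl of `aR`), for every `N ≥ 1` with
`N + R₀ + 2 ≤ R`:
`∀ α, Σ_p ‖(du α)_p‖_F² ≤ 2·(2·(2 + 18·3²)·Σ_{y∈Q_{R₀}(z₀)}Σ_μΣ_ν wt² + 2·#Q_{3R+1}(z₀)·(9·((2∕R)·(3·(C₁∕N²)·M₀))²))` — the pinned curl energy of the dressed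
push is twice KNIT-D's energy row read on the dressing box. [cite: Balaban1984PropagatorsII, (1.9) p.226] [cite: GrossCMP1983, Thm 2.2] -/
theorem energy_row (F : T3Family) (K : ℕ) {lo hi : Fin (F.P K).d → ℤ} (hN : ∀ κ, hi κ - lo κ < (F.P K).sitesPerDir 0)
    {C₁ : ℝ} (hC₁ : 0 ≤ C₁)
    (hK1 : ∀ (e : Fin 3) (w : Zd 3) (n : ℕ), 1 ≤ n → w ∉ box (0 : Zd 3) ((n : ℤ) - 1) →
      |latticeGreen (w + unitVec e) - latticeGreen w| ≤ C₁ / (n : ℝ) ^ 2)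
    (wt βt : Zd (F.P K).d → Fin (F.P K).d → Fin (F.P K).d → ℝ) (at' : Zd (F.P K).d → Fin (F.P K).d → ℝ)
    (γt : Zd (F.P K).d → Fin (F.P K).d → Fin (F.P K).d → Fin (F.P K).d → ℝ)
    (z₀ : Zd (F.P K).d) (R₀ : ℕ)
    (hwt0 : ∀ x, x ∉ box z₀ (R₀ : ℤ) → ∀ μ ν, wt x μ ν = 0)
    (hβt : ∀ x μ ν, βt x μ ν = ∑ y ∈ box z₀ (R₀ : ℤ), latticeGreen (x - y) / 2 * wt y μ ν)
    (hat : ∀ x ν, at' x ν = ∑ μ, (βt (x - unitVec μ) μ ν - βt x μ ν))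
    (hγt : ∀ x κ μ ν, γt x κ μ ν =
      (βt (x + unitVec κ) μ ν - βt x μ ν) - (βt (x + unitVec μ) κ ν - βt x κ ν) + (βt (x + unitVec ν) κ μ - βt x κ μ))
    (χ : Zd (F.P K).d → ℝ) (aR : Zd (F.P K).d → Fin (F.P K).d → ℝ) (daR : Zd (F.P K).d → Fin (F.P K).d → Fin (F.P K).d → ℝ) (R : ℕ)
    (hχ01 : ∀ x, 0 ≤ χ x ∧ χ x ≤ 1) (hχ1 : ∀ x ∈ box z₀ (R : ℤ), χ x = 1) (hχ0 : ∀ x, x ∉ box z₀ (3 * (R : ℤ)) → χ x = 0)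
    (hχp : ∀ x (μ : Fin (F.P K).d), |χ (x + unitVec μ) - χ x| ≤ 2 / (R : ℝ))
    (haR : ∀ x ν, aR x ν = χ x * at' x ν)
    (hdaR : ∀ x μ ν, daR x μ ν = (aR (x + unitVec μ) ν - aR x ν) - (aR (x + unitVec ν) μ - aR x μ))
    (haR1 : ∀ x μ, aR x μ ≠ 0 → lo + 1 ≤ x ∧ x + unitVec μ + 1 ≤ hi)
    (u0 : PBond (F.P K) 0 → ℝ)
    (hu0 : ∀ (x : Fin (F.P K).d → ℤ) (μ : Fin (F.P K).d), lo ≤ x → x + e μ ≤ hi → u0 ⟨castSite x, μ⟩ = aR x μ)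
    (hu0off : ∀ b : PBond (F.P K) 0, (¬ ∃ y : Fin (F.P K).d → ℤ, lo ≤ y ∧ y + e b.dir ≤ hi ∧ b.src = castSite y) → u0 b = 0)
    (N : ℕ) (hN1 : 1 ≤ N) (hNR : (N : ℤ) + R₀ + 2 ≤ R) :
    ∀ α : Fin 3, ∑ p : Plaq (F.P K) 0,
        ‖((u0 (slotBond p 0) : ℝ) : ℂ) • (I • pauli α) + ((u0 (slotBond p 1) : ℝ) : ℂ) • (I • pauli α) -
          ((u0 (slotBond p 2) : ℝ) : ℂ) • (I • pauli α) - ((u0 (slotBond p 3) : ℝ) : ℂ) • (I • pauli α)‖ ^ 2 ≤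
      2 * (2 * ((2 + 18 * (3 : ℝ) ^ 2) * ∑ y ∈ box z₀ (R₀ : ℤ), ∑ μ : Fin 3, ∑ ν : Fin 3, wt y μ ν ^ 2)
        + 2 * ((((box z₀ (3 * (R : ℤ) + 1)).card : ℕ) : ℝ) *
          (9 * (2 / (R : ℝ) * (3 * (C₁ / (N : ℝ) ^ 2) *
            ∑ μ' : Fin 3, ∑ ν' : Fin 3, ∑ y' ∈ box z₀ (R₀ : ℤ), |wt y' μ' ν'|)) ^ 2))) := by
  classical
  intro α
  rw [sum_norm_sq_curl_dress]
  refine mul_le_mul_of_nonneg_left ?_ (by norm_num)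
  -- torus → the dressing box `Π[lo,hi]`, in the `Fin 3` letters of KNIT-D (the seam `(F.P K).d = 3` is `rfl`)
  have h1 : ∑ p : Plaq (F.P K) 0, (u0 (slotBond p 0) + u0 (slotBond p 1) - u0 (slotBond p 2) - u0 (slotBond p 3)) ^ 2 ≤
      ∑ z ∈ Fintype.piFinset (fun i => Finset.Icc (lo i) (hi i)), ∑ μ : Fin 3, ∑ ν : Fin 3, daR z μ ν ^ 2 := by
    have h := sum_sq_curl_push_le_sum_sum_box hN aR haR1 u0 hu0 hu0off
    simp only [← hdaR] at h
    exact h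
  -- KNIT-D's energy row with `B := Π[lo,hi]`, `S := 3R`, `ρ := 2∕R`
  have hχ0' : ∀ x : Zd 3, x ∉ box z₀ ((3 * R : ℕ) : ℤ) → χ x = 0 := by
    intro x hx
    apply hχ0
    push_cast at hx
    exact hx
  have h2 := sum_sq_curl_truncated_le_far' hK1 wt βt at' γt z₀ R₀ hwt0 hβt hat hγt χ aR daR R (3 * R) hχ01 hχ1 hχ0' hχp haR hdaR
    hC₁ N hN1 hNR (Fintype.piFinset fun i => Finset.Icc (lo i) (hi i))
  have hcast : (((3 * R : ℕ) : ℤ)) = 3 * (R : ℤ) := by push_cast; ring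
  rw [hcast] at h2
  exact h1.trans h2

/-! ## §3 (R5) all the way to `C5·L^j` -/

/-- **THE ARITHMETIC OF (R5)**: with `1 ≤ Lj`, `S2 ≤ 2·Lj`, `0 ≤ M₀ ≤ 2·Lj²`, `Q ≤ 729·R³`, `1 ≤ N`, `R ≤ 2N`, `12·Lj³ ≤ R`:
`2·(2·((2 + 18·3²)·S2) + 2·(Q·(9·((2∕R)·(3·(C₁∕N²)·M₀))²))) ≤ (1312 + 34992·C₁²)·Lj` (far term `≤ 8748·C₁²` since `324·Q·M₀² ≤ 8748·(R·N²)²`;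
main term `656·S2 ≤ 1312·Lj`). [folklore] -/
theorem energy_arith {Lj R N M₀ S2 Q C₁ : ℝ} (hLj : 1 ≤ Lj) (hS2 : S2 ≤ 2 * Lj)
    (hM0 : 0 ≤ M₀) (hM : M₀ ≤ 2 * Lj ^ 2) (hQ : Q ≤ 729 * R ^ 3) (hN1 : 1 ≤ N) (hRN : R ≤ 2 * N)
    (hRL : 12 * Lj ^ 3 ≤ R) :
    2 * (2 * ((2 + 18 * (3 : ℝ) ^ 2) * S2) + 2 * (Q * (9 * (2 / R * (3 * (C₁ / N ^ 2) * M₀)) ^ 2)))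
      ≤ (1312 + 34992 * C₁ ^ 2) * Lj := by
  have hR12 : 12 ≤ R := le_trans (by nlinarith [pow_le_pow_left₀ zero_le_one hLj 3, one_pow (M := ℝ) 3]) hRL
  have hR0 : 0 < R := lt_of_lt_of_le (by norm_num) hR12
  have hN0 : 0 < N := lt_of_lt_of_le one_pos hN1
  -- the far-field term
  have hX : 2 / R * (3 * (C₁ / N ^ 2) * M₀) = 6 * C₁ * M₀ / (R * N ^ 2) := by
    field_simp
    ring
  have hT : Q * (9 * (2 / R * (3 * (C₁ / N ^ 2) * M₀)) ^ 2) = 324 * Q * M₀ ^ 2 * C₁ ^ 2 / (R * N ^ 2) ^ 2 := by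
    rw [hX, div_pow]
    ring
  have h1 : R ^ 4 ≤ 16 * N ^ 4 := by
    have h := pow_le_pow_left₀ hR0.le hRN 4
    nlinarith [h]
  have h2 : 1728 * Lj ^ 9 ≤ R ^ 3 := by
    have h := pow_le_pow_left₀ (by positivity) hRL 3
    nlinarith [h]
  have h3 : Lj ^ 4 ≤ Lj ^ 9 := pow_le_pow_right₀ hLj (by norm_num)
  have h4 : Q * M₀ ^ 2 ≤ 729 * R ^ 3 * (4 * Lj ^ 4) := by
    have hM2 : M₀ ^ 2 ≤ (2 * Lj ^ 2) ^ 2 := pow_le_pow_left₀ hM0 hM 2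
    have : (2 * Lj ^ 2) ^ 2 = 4 * Lj ^ 4 := by ring
    rw [this] at hM2
    exact mul_le_mul hQ hM2 (sq_nonneg _) (by positivity)
  have hkey : 324 * Q * M₀ ^ 2 ≤ 8748 * (R * N ^ 2) ^ 2 := by
    calc 324 * Q * M₀ ^ 2 = 324 * (Q * M₀ ^ 2) := by ring
      _ ≤ 324 * (729 * R ^ 3 * (4 * Lj ^ 4)) := by gcongr
      _ = 944784 * R ^ 3 * Lj ^ 4 := by ring
      _ ≤ 944784 * R ^ 3 * Lj ^ 9 := by gcongr
      _ = (2187 / 4) * R ^ 3 * (1728 * Lj ^ 9) := by ring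
      _ ≤ (2187 / 4) * R ^ 3 * R ^ 3 := by gcongr
      _ = (2187 / 4) * R ^ 2 * R ^ 4 := by ring
      _ ≤ (2187 / 4) * R ^ 2 * (16 * N ^ 4) := by gcongr
      _ = 8748 * (R * N ^ 2) ^ 2 := by ring
  have hfar : Q * (9 * (2 / R * (3 * (C₁ / N ^ 2) * M₀)) ^ 2) ≤ 8748 * C₁ ^ 2 := by
    rw [hT, div_le_iff₀ (by positivity)]
    have hC2 : 0 ≤ C₁ ^ 2 := sq_nonneg _
    calc 324 * Q * M₀ ^ 2 * C₁ ^ 2 = (324 * Q * M₀ ^ 2) * C₁ ^ 2 := by ring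
      _ ≤ (8748 * (R * N ^ 2) ^ 2) * C₁ ^ 2 := mul_le_mul_of_nonneg_right hkey hC2
      _ = 8748 * C₁ ^ 2 * (R * N ^ 2) ^ 2 := by ring
  -- assemble
  have hmain : (2 + 18 * (3 : ℝ) ^ 2) * S2 ≤ 164 * (2 * Lj) := by
    norm_num
    nlinarith
  have hC2Lj : C₁ ^ 2 ≤ C₁ ^ 2 * Lj := le_mul_of_one_le_right (sq_nonneg _) hLj
  nlinarith [hfar, hmain, hC2Lj, sq_nonneg C₁]

/-- ★★★ **(R5) ALL THE WAY TO `C5·L^j`** (★w2-19936 g15 22:39:30Z «(R5) next — yours»).  In the KNIT-E2 skeleton's binders — the read-out `wt` through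
its `hwt` letter itself (`wt y μ ν = if y ∈ Q_{R₀}(z₀) then ±linWeight j a ⟨castSite y, ·, ·⟩ else 0`), the chart box non-wrapping (`2R₀ < sitesPerDir 0`),
`1 ≤ j ≤ m + K`, the `ℤ³` objects `βt at' γt χ aR daR` with their defining rows, the push `u0` of `aR`, and the size rows the skeleton's
`R = (R₀+12)·L^{3j}`, `N := R − R₀ − 2` satisfy (`1 ≤ N`, `N + R₀ + 2 ≤ R`, `R ≤ 2N`, `12·(L^j)³ ≤ R`):
`∀ α, Σ_p ‖(du α)_p‖_F² ≤ (1312 + 34992·C₁²)·L^j`.  The bullet closes by `exact` + `C5 ≤ C`. [cite: Balaban1984PropagatorsII, (1.9) p.226]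
[cite: GrossCMP1983, Thm 2.2] -/
theorem energy_row_le (F : T3Family) (K : ℕ) {lo hi : Fin (F.P K).d → ℤ} (hN : ∀ κ, hi κ - lo κ < (F.P K).sitesPerDir 0)
    {C₁ : ℝ} (hC₁ : 0 ≤ C₁)
    (hK1 : ∀ (e : Fin 3) (w : Zd 3) (n : ℕ), 1 ≤ n → w ∉ box (0 : Zd 3) ((n : ℤ) - 1) →
      |latticeGreen (w + unitVec e) - latticeGreen w| ≤ C₁ / (n : ℝ) ^ 2)
    {j : ℕ} (a : Plaq (F.P K) j) (hjmK : j ≤ (F.P K).m + (F.P K).K)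
    (wt βt : Zd (F.P K).d → Fin (F.P K).d → Fin (F.P K).d → ℝ) (at' : Zd (F.P K).d → Fin (F.P K).d → ℝ)
    (γt : Zd (F.P K).d → Fin (F.P K).d → Fin (F.P K).d → Fin (F.P K).d → ℝ)
    (z₀ : Zd (F.P K).d) (R₀ : ℕ) (hR₀ : 2 * (R₀ : ℤ) < (F.P K).sitesPerDir 0)
    (hwt : ∀ y μ ν, wt y μ ν =
      if y ∈ box z₀ (R₀ : ℤ) then
        (if h : μ < ν then linWeight j a ⟨castSite y, μ, ν, h⟩ else if h' : ν < μ then -linWeight j a ⟨castSite y, ν, μ, h'⟩ else 0)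
      else 0)
    (hβt : ∀ x μ ν, βt x μ ν = ∑ y ∈ box z₀ (R₀ : ℤ), latticeGreen (x - y) / 2 * wt y μ ν)
    (hat : ∀ x ν, at' x ν = ∑ μ, (βt (x - unitVec μ) μ ν - βt x μ ν))
    (hγt : ∀ x κ μ ν, γt x κ μ ν =
      (βt (x + unitVec κ) μ ν - βt x μ ν) - (βt (x + unitVec μ) κ ν - βt x κ ν) + (βt (x + unitVec ν) κ μ - βt x κ μ))
    (χ : Zd (F.P K).d → ℝ) (aR : Zd (F.P K).d → Fin (F.P K).d → ℝ) (daR : Zd (F.P K).d → Fin (F.P K).d → Fin (F.P K).d → ℝ) (R : ℕ)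
    (hχ01 : ∀ x, 0 ≤ χ x ∧ χ x ≤ 1) (hχ1 : ∀ x ∈ box z₀ (R : ℤ), χ x = 1) (hχ0 : ∀ x, x ∉ box z₀ (3 * (R : ℤ)) → χ x = 0)
    (hχp : ∀ x (μ : Fin (F.P K).d), |χ (x + unitVec μ) - χ x| ≤ 2 / (R : ℝ))
    (haR : ∀ x ν, aR x ν = χ x * at' x ν)
    (hdaR : ∀ x μ ν, daR x μ ν = (aR (x + unitVec μ) ν - aR x ν) - (aR (x + unitVec ν) μ - aR x μ))
    (haR1 : ∀ x μ, aR x μ ≠ 0 → lo + 1 ≤ x ∧ x + unitVec μ + 1 ≤ hi)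
    (u0 : PBond (F.P K) 0 → ℝ)
    (hu0 : ∀ (x : Fin (F.P K).d → ℤ) (μ : Fin (F.P K).d), lo ≤ x → x + e μ ≤ hi → u0 ⟨castSite x, μ⟩ = aR x μ)
    (hu0off : ∀ b : PBond (F.P K) 0, (¬ ∃ y : Fin (F.P K).d → ℤ, lo ≤ y ∧ y + e b.dir ≤ hi ∧ b.src = castSite y) → u0 b = 0)
    (N : ℕ) (hN1 : 1 ≤ N) (hNR : (N : ℤ) + R₀ + 2 ≤ R) (hRN : R ≤ 2 * N) (hRL : 12 * F.L ^ (3 * j) ≤ R) :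
    ∀ α : Fin 3, ∑ p : Plaq (F.P K) 0,
        ‖((u0 (slotBond p 0) : ℝ) : ℂ) • (I • pauli α) + ((u0 (slotBond p 1) : ℝ) : ℂ) • (I • pauli α) -
          ((u0 (slotBond p 2) : ℝ) : ℂ) • (I • pauli α) - ((u0 (slotBond p 3) : ℝ) : ℂ) • (I • pauli α)‖ ^ 2 ≤
      (1312 + 34992 * C₁ ^ 2) * (F.L : ℝ) ^ j := by
  intro α
  have hwt0 : ∀ x, x ∉ box z₀ (R₀ : ℤ) → ∀ μ ν, wt x μ ν = 0 := fun x hx μ ν => readout_of_not_mem a z₀ R₀ wt hwt hx μ ν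
  refine (energy_row F K hN hC₁ hK1 wt βt at' γt z₀ R₀ hwt0 hβt hat hγt χ aR daR R hχ01 hχ1 hχ0 hχp haR hdaR haR1 u0 hu0 hu0off
    N hN1 hNR α).trans ?_
  -- the STEP-0 prices of the read-out (the `Fin (F.P K).d = Fin 3`, `(F.P K).L = F.L` seams are `rfl`)
  have hL1 : (1 : ℝ) ≤ (F.L : ℝ) := by exact_mod_cast le_of_lt F.hL.2
  have hL0 : (0 : ℝ) < (F.L : ℝ) := lt_of_lt_of_le one_pos hL1
  have hLj : (1 : ℝ) ≤ (F.L : ℝ) ^ j := one_le_pow₀ hL1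
  have hS2 : ∑ y ∈ box z₀ (R₀ : ℤ), ∑ μ : Fin 3, ∑ ν : Fin 3, wt y μ ν ^ 2 ≤ 2 * (F.L : ℝ) ^ j := by
    have h : ∑ y ∈ box z₀ (R₀ : ℤ), ∑ μ : Fin 3, ∑ ν : Fin 3, wt y μ ν ^ 2 ≤
        2 * ((((F.L : ℕ) : ℝ) * (F.L : ℕ) * ((((F.L : ℕ) : ℝ) ^ 3)⁻¹)) ^ j * (((F.L : ℕ) : ℝ) * (F.L : ℕ)) ^ j) :=
      readout_sq_sum_le a z₀ R₀ wt hwt hR₀ hjmK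
    have e : (((F.L : ℕ) : ℝ) * (F.L : ℕ) * ((((F.L : ℕ) : ℝ) ^ 3)⁻¹)) ^ j * (((F.L : ℕ) : ℝ) * (F.L : ℕ)) ^ j = (F.L : ℝ) ^ j := by
      rw [← mul_pow]
      congr 1
      field_simp
    rw [e] at h
    exact h
  have hM0 : 0 ≤ ∑ μ' : Fin 3, ∑ ν' : Fin 3, ∑ y' ∈ box z₀ (R₀ : ℤ), |wt y' μ' ν'| :=
    Finset.sum_nonneg fun _ _ => Finset.sum_nonneg fun _ _ => Finset.sum_nonneg fun _ _ => abs_nonneg _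
  have hM : ∑ μ' : Fin 3, ∑ ν' : Fin 3, ∑ y' ∈ box z₀ (R₀ : ℤ), |wt y' μ' ν'| ≤ 2 * ((F.L : ℝ) ^ j) ^ 2 := by
    have h : ∑ μ' : Fin 3, ∑ ν' : Fin 3, ∑ y' ∈ box z₀ (R₀ : ℤ), |wt y' μ' ν'| ≤ 2 * (((F.L : ℕ) : ℝ) * (F.L : ℕ)) ^ j :=
      readout_abs_sum_le a z₀ R₀ wt hwt hR₀
    have e : (((F.L : ℕ) : ℝ) * (F.L : ℕ)) ^ j = ((F.L : ℝ) ^ j) ^ 2 := by rw [sq, mul_pow]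
    rw [e] at h
    exact h
  -- the shell count
  have hR12 : (12 : ℝ) ≤ (R : ℝ) := by
    have h1 : 1 ≤ F.L ^ (3 * j) := Nat.one_le_pow _ _ (le_of_lt F.hL.2)
    have : 12 ≤ R := le_trans (by omega) hRL
    exact_mod_cast this
  have hQ : (((box z₀ (3 * (R : ℤ) + 1)).card : ℕ) : ℝ) ≤ 729 * (R : ℝ) ^ 3 := by
    have hr : (0 : ℤ) ≤ 3 * (R : ℤ) + 1 := by positivity
    rw [card_box z₀ hr, T3Family.P_d]
    push_cast
    have h9 : 2 * (3 * (R : ℝ) + 1) + 1 ≤ 9 * (R : ℝ) := by linarith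
    have h0 : (0 : ℝ) ≤ 2 * (3 * (R : ℝ) + 1) + 1 := by positivity
    calc (2 * (3 * (R : ℝ) + 1) + 1) ^ 3 ≤ (9 * (R : ℝ)) ^ 3 := pow_le_pow_left₀ h0 h9 3
      _ = 729 * (R : ℝ) ^ 3 := by ring
  have hRN' : (R : ℝ) ≤ 2 * (N : ℝ) := by exact_mod_cast hRN
  have hN1' : (1 : ℝ) ≤ (N : ℝ) := by exact_mod_cast hN1
  have hRL' : 12 * ((F.L : ℝ) ^ j) ^ 3 ≤ (R : ℝ) := by
    rw [← pow_mul, mul_comm j 3]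
    exact_mod_cast hRL
  exact energy_arith hLj hS2 hM0 hM hQ hN1' hRN' hRL'

end Summit.QuantumFields.YangMills.Theorems.GrossTransferStubLinTestEnergyMassRows

end
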